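import Literature.Probability.LatticeModels.FKInterfacePairing
import Literature.Probability.LatticeModels.CornerPermutation
import HarnessLib

/-!
# The FK-Ising observable as a finite sum over cut orbits; lines of darts and of `cornerLine`

Topic `Literature/Probability/LatticeModels`; sixth instalment of the discharge programme for
crit-ising.S18, node 1 (s-holomorphicity of the critical FK-Ising observable, corrected form
`isSHolomorphic_fkIsingObservable_of_zdArcA_connected` of `FKInterfacePairing.lean`). This file
rewrites H21's observable in the coded-corner language of `MedialInterfaceProofs.lean` and settles
the "Lemma 4.1" part of Smirnov's argument (complex weights lie on prescribed lines) together with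
the identification of H21's projection lines. Everything here is proved.

* `startCorner`, `exitTime`, `medialExploration_eq_explorationList`: for admissible data the FK
  interface of the completed configuration is the cut orbit `explorationList β c₀ N` (existence
  and uniqueness, `existsUnique_medialExploration_holds`); `passageSum_explorationList`: its
  passages through `z` are the positions `k ≤ N` with `cSrc (orb k) = z`;
  `fkIsingObservable_eq_sum`: `F(z) = ∑_{ω ⊆ E} (w(ω)/Z) · passageSum (γ_ω) z`
  (`integral_fkInterfaceMeasure`).
* `turnCount`, `snd_cornerOrbit_eq`, `turnCount_emod_four`: the winding of the `k`-th dart is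
  `(π/2) · turnCount k` (`ExplorationWinding`) and **`turnCount k ≡ dartDir (orb k) (mod 4)`**,
  the direction index of its corner — the face index of a coded corner records its direction.
* `quarterPhase n = e^{-iπ n/4}` (the spin-`1/2` weight of `n` quarter turns), the spinor sign
  rule `quarterPhase (n + 4) = -quarterPhase n` (Smirnov's Remark 4.2: a `2π` twist gives `-1`)
  and **`quarterPhase_turnCount`** (Lemma 4.1): the weight of a dart is `±` the weight of its
  direction index, so parallel darts carry weights on one real line.
* `cornerLine_sq'`, `cornerLine_eq_or_eq_neg`: H21's `cornerLine` at the coded corner `q` is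
  `± 2^{1/4} · refPhase c₀ · quarterPhase (dartDir c₀ q)` — a fixed rotation (by the constant
  `refPhase c₀`, a square root of `e^{-3iπ/4}` times `e^{-iπ k₀/4}`) of the dart line; obtained
  by comparing squares (`cornerLine² = (x^{-1/2})² = x⁻¹`), so no branch of the square root and
  no trigonometric values are needed.
* `projLine_real_mul`, `projLine_neg`, `projLine_mul_mul`: projections depend only on the real
  line, and `Proj[uF; uηℝ] = u · Proj[F; ηℝ]` for every `u ≠ 0`; hence s-holomorphicity of
  `refPhase c₀ · F` for `cornerLine` is s-holomorphicity of `F` for the dart lines.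

What remains for the discharge (next instalments): the per-pair identities of Smirnov's table
(proof of Lemma 4.5) along the three pieces of `InterfaceRearrangement.lean`, which need two
planar-topology inputs (a closed cycle of the turning rule has odd rotation number; a cycle
through the partner that misses the interface cycle separates the endpoints of the toggled edge).

Sources: Smirnov, Ann. Math. 172 (2010), §2.2 eq. (2.2), Def. 3.1, Lemma 4.1, Remark 4.2, §4;
Chelkak–Smirnov, Invent. Math. 189 (2012), §3.2 (projections `Pr[F; ℓ]`).
-/

noncomputable section

namespace Literature.Probability.LatticeModels

open MeasureTheory Finset

namespace DiscreteDobrushin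

variable {D : DiscreteDobrushin}

/-- The start corner of admissible Dobrushin data (the unique one, `existsUnique_startCorner`),
as a definite object. [cite: Smirnov2001, §2] -/
def startCorner (hD : D.IsZdAdmissible) : Site 2 × Fin 4 :=
  (existsUnique_startCorner hD).exists.choose

/-- The chosen start corner is a start corner. [cite: Smirnov2001, §2] -/
theorem isStartCorner_startCorner (hD : D.IsZdAdmissible) : D.IsStartCorner (startCorner hD) :=
  let h := (existsUnique_startCorner hD).exists.choose_spec
  ⟨h.1, h.2.1, h.2.2⟩

open scoped Classical in
/-- The exit time of the exploration of the completed configuration `D.bcBondConfig ω`: the first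
time the orbit of the start corner reaches a corner with non-inner face. [cite: Smirnov2001, §2] -/
def exitTime (hD : D.IsZdAdmissible) (ω : Percolation.BondConfig (Site 2)) : ℕ :=
  Nat.find (exists_not_isInnerFace_cornerOrbit (ω := ω) hD (isStartCorner_startCorner hD))

/-- At the exit time the face is not inner. [cite: Smirnov2001, §2] -/
theorem not_isInnerFace_exitTime (hD : D.IsZdAdmissible) (ω : Percolation.BondConfig (Site 2)) :
    ¬ D.IsInnerFace (cFace (cornerOrbit (D.bcBondConfig ω) (startCorner hD) (exitTime hD ω))) := by
  classical
  exact Nat.find_spec (exists_not_isInnerFace_cornerOrbit (ω := ω) hD (isStartCorner_startCorner hD))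

/-- Before the exit time all faces are inner. [cite: Smirnov2001, §2] -/
theorem isInnerFace_of_lt_exitTime (hD : D.IsZdAdmissible) (ω : Percolation.BondConfig (Site 2)) {k : ℕ}
    (hk : k < exitTime hD ω) :
    D.IsInnerFace (cFace (cornerOrbit (D.bcBondConfig ω) (startCorner hD) k)) := by
  classical
  exact not_not.1 (Nat.find_min (exists_not_isInnerFace_cornerOrbit (ω := ω) hD (isStartCorner_startCorner hD)) hk)

/-- The exit time is positive (the start corner has an inner face). [cite: Smirnov2001, §2] -/
theorem exitTime_pos (hD : D.IsZdAdmissible) (ω : Percolation.BondConfig (Site 2)) : 0 < exitTime hD ω := by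
  by_contra h
  have h0 : exitTime hD ω = 0 := by omega
  have := not_isInnerFace_exitTime hD ω
  rw [h0] at this
  exact this (isStartCorner_startCorner hD).isOutEdge.1

/-- **The medial exploration is the cut orbit** from the start corner to the exit time
(existence and uniqueness, `MedialInterfaceProofs`). [cite: Smirnov2001, §2] -/
theorem medialExploration_eq_explorationList (hD : D.IsZdAdmissible) (ω : Percolation.BondConfig (Site 2)) :
    medialExploration D ω = explorationList (D.bcBondConfig ω) (startCorner hD) (exitTime hD ω) :=
  (isMedialExploration_medialExploration_holds D hD ω).eq_explorationList hD
    (isStartCorner_startCorner hD) (not_isInnerFace_exitTime hD ω) (fun _ hk => isInnerFace_of_lt_exitTime hD ω hk)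

end DiscreteDobrushin

/-! ### Passage sums along the cut orbit -/

section PassageSum

variable {β : Percolation.BondConfig (Site 2)} {c₀ : Site 2 × Fin 4}

/-- The cut orbit has `N + 1` medial vertices (general configuration). [cite: Smirnov2001, §2] -/
theorem length_explorationList' (N : ℕ) : (explorationList β c₀ N).length = N + 1 := by
  simp [explorationList]

/-- The `i`-th medial vertex of the cut orbit is the source of the `i`-th orbit corner (general
configuration). [cite: Smirnov2001, §2] -/
theorem getElem_explorationList' {N i : ℕ} (h : i < (explorationList β c₀ N).length) :
    (explorationList β c₀ N)[i] = cSrc (cornerOrbit β c₀ i) := by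
  simp [explorationList]

/-- **Passages of the cut orbit through a medial vertex** are its positions `k ≤ N` whose corner
has source `z`: `passageSum` along `explorationList β c₀ N` is the sum over those `k` of
`exp (-i · spin · windingAt k)`. [cite: Smirnov2010, §2.2 eq. (2.2)] -/
theorem passageSum_explorationList (δ spin : ℝ) (N : ℕ) (z : MedialVertex) :
    passageSum (explorationList β c₀ N) δ spin z =
      ∑ k ∈ (Finset.range (N + 1)).filter (fun k => cSrc (cornerOrbit β c₀ k) = z),
        Complex.exp (-Complex.I * spin * (windingAt (explorationList β c₀ N) δ k : ℝ)) := by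
  rw [passageSum, length_explorationList']
  refine Finset.sum_congr ?_ fun _ _ => rfl
  refine Finset.filter_congr fun k hk => ?_
  rw [Finset.mem_range] at hk
  rw [List.getElem?_eq_getElem (by rw [length_explorationList']; exact hk), getElem_explorationList',
    Option.some.injEq]

end PassageSum

/-! ### The direction of a dart: face index ≡ start index + number of turns (mod 4) -/

section Direction

variable {β : Percolation.BondConfig (Site 2)} {c₀ : Site 2 × Fin 4}

/-- The running sum of turn signs `∑_{i<k} turnSign (orb i)` (an integer number of quarter
turns): the winding of the `k`-th dart is `(π/2) · turnCount k`. [cite: Smirnov2010, §4] -/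
def turnCount (β : Percolation.BondConfig (Site 2)) (c₀ : Site 2 × Fin 4) (k : ℕ) : ℤ :=
  ∑ i ∈ Finset.range k, turnSign β (cornerOrbit β c₀ i)

/-- `turnCount 0 = 0`. [cite: Smirnov2010, §4] -/
@[simp] theorem turnCount_zero : turnCount β c₀ 0 = 0 := by simp [turnCount]

/-- `turnCount (k+1) = turnCount k + turnSign (orb k)`. [cite: Smirnov2010, §4] -/
theorem turnCount_succ (k : ℕ) : turnCount β c₀ (k + 1) = turnCount β c₀ k + turnSign β (cornerOrbit β c₀ k) := by
  rw [turnCount, Finset.sum_range_succ, turnCount]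

/-- **The face index of a dart records its direction**: the `k`-th orbit corner has face index
`c₀.2 + turnCount k (mod 4)` — crossing a closed edge turns left and moves to the next face
counter-clockwise (`+1`), following an open edge turns right and lands in the face `k + 3 ≡ k - 1`.
(Stated in `ZMod 4 = Fin 4`, whose ring structure carries the cast from `ℤ`.)
[cite: Smirnov2010, §4] -/
theorem snd_cornerOrbit_eq (k : ℕ) :
    (show ZMod 4 from (cornerOrbit β c₀ k).2) = (show ZMod 4 from c₀.2) + (turnCount β c₀ k : ZMod 4) := by
  induction k with
  | zero => simp; rfl
  | succ k ih =>
    rw [turnCount_succ, Int.cast_add, ← add_assoc, ← ih]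
    change (show ZMod 4 from (nextCorner β (cornerOrbit β c₀ k)).2) = _
    classical
    unfold turnSign
    split_ifs with h
    · rw [nextCorner_of_mem h]
      simp only [Int.reduceNeg, Int.cast_neg, Int.cast_one]
      have : ∀ j : ZMod 4, j + 3 = j + -1 := by decide
      exact this _
    · rw [nextCorner_of_not_mem h]
      simp only [Int.cast_one]
      rfl

/-- The *direction index* of the coded corner `q` relative to the start corner: the number of
quarter turns (mod `4`, in `{0,1,2,3}`) from the direction of the first dart to the direction of
`q` (corners with equal face index are parallel). [cite: Smirnov2010, §4] -/
def dartDir (c₀ q : Site 2 × Fin 4) : ℕ := (q.2 - c₀.2).val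

/-- The direction index is `< 4`. [cite: Smirnov2010, §4] -/
theorem dartDir_lt (c₀ q : Site 2 × Fin 4) : dartDir c₀ q < 4 := (q.2 - c₀.2).isLt

/-- **The winding of a dart is its direction index modulo `4`** (in quarter turns).
[cite: Smirnov2010, Lemma 4.1] -/
theorem turnCount_emod_four (k : ℕ) : turnCount β c₀ k % 4 = dartDir c₀ (cornerOrbit β c₀ k) := by
  have h := snd_cornerOrbit_eq (β := β) (c₀ := c₀) k
  have h2 : (show ZMod 4 from ((cornerOrbit β c₀ k).2 - c₀.2)) = (turnCount β c₀ k : ZMod 4) := by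
    rw [show (show ZMod 4 from ((cornerOrbit β c₀ k).2 - c₀.2)) =
      (show ZMod 4 from (cornerOrbit β c₀ k).2) - (show ZMod 4 from c₀.2) from rfl, h]
    ring
  have h3 := congrArg (fun x : ZMod 4 => (x.val : ℤ)) h2
  simp only at h3
  rw [ZMod.val_intCast] at h3
  have h4 : ((4 : ℕ) : ℤ) = 4 := rfl
  rw [h4] at h3
  rw [← h3]
  rfl

end Direction

/-! ### Quarter-turn phases and the line of a dart -/

section Phases

open Complex

/-- The spin-`1/2` weight of a winding of `n` quarter turns: `exp (-i · ½ · (π/2) n) = e^{-iπn/4}`.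
[cite: Smirnov2010, §4 eq. (4.3)] -/
def quarterPhase (n : ℤ) : ℂ := exp (-(Real.pi / 4 * n) * I)

/-- Four more quarter turns (a full `2π` twist) flip the sign of the weight — the spinor
property "an additional `2π` turn changes the weight by a factor of `-1`" (Smirnov 2010, §2.2 and
Remark 4.2). [cite: Smirnov2010, Remark 4.2] -/
theorem quarterPhase_add_four (n : ℤ) : quarterPhase (n + 4) = -quarterPhase n := by
  rw [quarterPhase, quarterPhase, Int.cast_add]
  push_cast
  rw [show -(Real.pi / 4 * (n + 4)) * I = -(Real.pi / 4 * n) * I + (-Real.pi) * I by ring, exp_add]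
  rw [show (-Real.pi : ℂ) * I = -(Real.pi * I) by ring, exp_neg, exp_pi_mul_I]
  ring

/-- Weights of windings that agree modulo four quarter turns are real multiples (`±1`) of each
other. [cite: Smirnov2010, Remark 4.2] -/
theorem quarterPhase_add_four_mul (n m : ℤ) : quarterPhase (n + 4 * m) = (-1) ^ m.natAbs * quarterPhase n := by
  -- induction on `m` through `|m|`, both signs
  suffices h : ∀ k : ℕ, quarterPhase (n + 4 * k) = (-1) ^ k * quarterPhase n ∧
      quarterPhase (n - 4 * k) = (-1) ^ k * quarterPhase n by
    rcases Int.natAbs_eq m with hm | hm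
    · rw [hm, Int.natAbs_natCast]; exact (h _).1
    · rw [hm, Int.natAbs_neg, Int.natAbs_natCast, mul_neg, ← sub_eq_add_neg]; exact (h _).2
  intro k
  induction k with
  | zero => simp
  | succ k ih =>
    constructor
    · rw [show n + 4 * ((k + 1 : ℕ) : ℤ) = (n + 4 * k) + 4 by push_cast; ring, quarterPhase_add_four, ih.1]
      ring
    · have := quarterPhase_add_four (n - 4 * ((k + 1 : ℕ) : ℤ))
      rw [show n - 4 * ((k + 1 : ℕ) : ℤ) + 4 = n - 4 * k by push_cast; ring, ih.2] at this
      rw [show quarterPhase (n - 4 * ((k + 1 : ℕ) : ℤ)) = -((-1) ^ k * quarterPhase n) by rw [this]; ring]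
      ring

/-- The weight of `n` quarter turns is `±` the weight of `n % 4` quarter turns. [cite: Smirnov2010, Remark 4.2] -/
theorem quarterPhase_eq_sign_mul_emod (n : ℤ) :
    quarterPhase n = (-1) ^ (n / 4).natAbs * quarterPhase (n % 4) := by
  conv_lhs => rw [← Int.emod_add_mul_ediv n 4]
  exact quarterPhase_add_four_mul _ _

/-- `quarterPhase n` is a unit complex number. [cite: Smirnov2010, §4] -/
theorem norm_quarterPhase (n : ℤ) : ‖quarterPhase n‖ = 1 := by
  rw [quarterPhase, show -(Real.pi / 4 * (n : ℂ)) * I = ((-(Real.pi / 4 * n) : ℝ) : ℂ) * I by push_cast; ring,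
    norm_exp_ofReal_mul_I]

/-- **Lemma 4.1 (the weight of a dart lies on the line of its direction).** The spin weight
`e^{-iπ C_k/4}` of the `k`-th dart (`C_k = turnCount k` quarter turns) is `±` the weight
`e^{-iπ d/4}` of its direction index `d = dartDir c₀ (orb k)`: parallel darts carry weights on
one real line. (Smirnov 2010, Lemma 4.1: "the complex weight belongs to the line `ℓ(z)`".)
[cite: Smirnov2010, Lemma 4.1] -/
theorem quarterPhase_turnCount (β : Percolation.BondConfig (Site 2)) (c₀ : Site 2 × Fin 4) (k : ℕ) :
    quarterPhase (turnCount β c₀ k) =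
      (-1) ^ (turnCount β c₀ k / 4).natAbs * quarterPhase (dartDir c₀ (cornerOrbit β c₀ k)) := by
  rw [quarterPhase_eq_sign_mul_emod, turnCount_emod_four]

end Phases

/-! ### The line of H21's `cornerLine`: a fixed rotation of the dart line -/

section CornerLine

open Complex

/-- The base of `cornerLine` at the coded corner `(v, k)`: `I · (w - u) = I^k (I - 1) / 2`, where
`u = v` and `w` is the centre of the `k`-th face at `v`. [cite: Smirnov2010, Def. 3.1] -/
theorem I_mul_faceCenter_sub (q : Site 2 × Fin 4) :
    I * (faceCenter (cFace q) - Site.toComplex q.1) = I ^ (q.2 : ℕ) * (I - 1) / 2 := by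
  obtain ⟨v, k⟩ := q
  simp only [cFace, faceAt, faceCenter]
  have hsub : Site.toComplex (v - cornerOff k) = Site.toComplex v - Site.toComplex (cornerOff k) := by
    apply Complex.ext <;> simp [Site.toComplex]
  rw [hsub]
  fin_cases k <;> (apply Complex.ext <;> simp [Site.toComplex, cornerOff, pow_succ] <;> ring)

/-- `cornerLine` squared is the inverse of its base (the principal power `x^{-1/2}` squares to
`x⁻¹`), so the *line* `cornerLine · ℝ` is determined without reference to the branch.
[cite: Smirnov2010, Def. 3.1] -/
theorem cornerLine_sq (q : Site 2 × Fin 4) :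
    cornerLine q.1 (cFace q) ^ 2 = (I ^ (q.2 : ℕ) * (I - 1) / 2)⁻¹ := by
  rw [cornerLine, I_mul_faceCenter_sub, sq]
  have hx : I ^ (q.2 : ℕ) * (I - 1) / 2 ≠ 0 := by
    refine div_ne_zero (mul_ne_zero (pow_ne_zero _ I_ne_zero) ?_) two_ne_zero
    intro h; have := congrArg Complex.re h; simp at this
  rw [← cpow_add _ _ hx, show (-(1 / 2 : ℂ)) + -(1 / 2) = -1 by ring, cpow_neg_one]

/-- `cornerLine² = (-1 - I) (-I)^k` at the coded corner `(v, k)`. [cite: Smirnov2010, Def. 3.1] -/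
theorem cornerLine_sq' (q : Site 2 × Fin 4) :
    cornerLine q.1 (cFace q) ^ 2 = (-1 - I) * (-I) ^ (q.2 : ℕ) := by
  rw [cornerLine_sq]
  refine inv_eq_of_mul_eq_one_right ?_
  rw [show I ^ (q.2 : ℕ) * (I - 1) / 2 * ((-1 - I) * (-I) ^ (q.2 : ℕ)) =
    ((I - 1) * (-1 - I) / 2) * (I * -I) ^ (q.2 : ℕ) by rw [mul_pow]; ring]
  have h1 : (I - 1) * (-1 - I) / 2 = 1 := by
    rw [show (I - 1) * (-1 - I) = -(I * I) + 1 by ring, I_mul_I]; norm_num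
  rw [h1, show I * -I = -(I * I) by ring, I_mul_I, neg_neg, one_pow, one_mul]

/-- The spin weight of two quarter turns per unit: `quarterPhase (2 n) = (-I)^n`. [cite: Smirnov2010, §4] -/
theorem quarterPhase_two_mul_nat (n : ℕ) : quarterPhase (2 * (n : ℤ)) = (-I) ^ n := by
  rw [quarterPhase]
  have : -(Real.pi / 4 * ((2 * (n : ℤ) : ℤ) : ℂ)) * I = (n : ℂ) * (-(Real.pi / 2 * I)) := by push_cast; ring
  rw [this, exp_nat_mul, exp_neg, exp_pi_div_two_mul_I, inv_I]

/-- The square of the quarter-turn weight doubles the count. [cite: Smirnov2010, §4] -/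
theorem quarterPhase_sq (n : ℤ) : quarterPhase n ^ 2 = quarterPhase (2 * n) := by
  rw [quarterPhase, quarterPhase, sq, ← exp_add]
  congr 1
  push_cast
  ring

/-- The **reference phase** of the Dobrushin data seen from the start corner `c₀ = (x₀, k₀)`: a
square root of `e^{-3iπ/4} = (-1 - I)/√2` times `e^{-iπ k₀/4}`. Multiplying the observable by
this constant turns the projection lines of the darts into H21's `cornerLine`s
(`cornerLine_eq_or_eq_neg`). [cite: Smirnov2010, Def. 3.1] -/
def refPhase (c₀ : Site 2 × Fin 4) : ℂ := ((-1 - I) / Real.sqrt 2) ^ (1 / 2 : ℂ) * quarterPhase (c₀.2 : ℕ)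

/-- `refPhase² = (-1 - I)/√2 · (-I)^{k₀}`. [cite: Smirnov2010, Def. 3.1] -/
theorem refPhase_sq (c₀ : Site 2 × Fin 4) : refPhase c₀ ^ 2 = (-1 - I) / Real.sqrt 2 * (-I) ^ (c₀.2 : ℕ) := by
  rw [refPhase, mul_pow, quarterPhase_sq, quarterPhase_two_mul_nat]
  congr 1
  have hx : (-1 - I) / (Real.sqrt 2 : ℂ) ≠ 0 := by
    refine div_ne_zero ?_ (by exact_mod_cast (Real.sqrt_pos.2 two_pos).ne')
    intro h; have := congrArg Complex.re h; simp at this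
  rw [sq, ← cpow_add _ _ hx, show (1 / 2 : ℂ) + 1 / 2 = 1 by ring, cpow_one]

/-- `refPhase c₀ ≠ 0`. [cite: Smirnov2010, Def. 3.1] -/
theorem refPhase_ne_zero (c₀ : Site 2 × Fin 4) : refPhase c₀ ≠ 0 := by
  intro h
  have := refPhase_sq c₀
  rw [h, sq, zero_mul] at this
  refine absurd this.symm (mul_ne_zero (div_ne_zero ?_ ?_) (pow_ne_zero _ (neg_ne_zero.2 I_ne_zero)))
  · intro h; have := congrArg Complex.re h; simp at this
  · exact_mod_cast (Real.sqrt_pos.2 two_pos).ne'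

/-- The direction index adds up: `k₀ + dartDir ≡ k (mod 4)`, as powers of `-I`. [cite: Smirnov2010, §4] -/
theorem negI_pow_add_dartDir (c₀ q : Site 2 × Fin 4) :
    (-I) ^ (c₀.2 : ℕ) * (-I) ^ dartDir c₀ q = (-I) ^ (q.2 : ℕ) := by
  rw [← pow_add, dartDir]
  have hmod : ((c₀.2 : ℕ) + (q.2 - c₀.2).val) % 4 = (q.2 : ℕ) := by
    have h := Fin.val_add c₀.2 (q.2 - c₀.2)
    rw [add_sub_cancel] at h
    exact h.symm
  conv_lhs => rw [← Nat.div_add_mod ((c₀.2 : ℕ) + (q.2 - c₀.2).val) 4, hmod, pow_add, pow_mul]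
  rw [show (-I) ^ 4 = 1 by rw [neg_pow, I_pow_four]; norm_num, one_pow, one_mul]

/-- **`cornerLine` lies on the rotated dart line**: `cornerLine² = √2 · (refPhase · quarterPhase d)²`
with `d = dartDir c₀ q`. [cite: Smirnov2010, Def. 3.1] -/
theorem cornerLine_sq_eq (c₀ q : Site 2 × Fin 4) :
    cornerLine q.1 (cFace q) ^ 2 = Real.sqrt 2 * (refPhase c₀ * quarterPhase (dartDir c₀ q)) ^ 2 := by
  rw [cornerLine_sq', mul_pow, refPhase_sq, quarterPhase_sq, quarterPhase_two_mul_nat, mul_assoc,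
    negI_pow_add_dartDir]
  have h2 : (Real.sqrt 2 : ℂ) ≠ 0 := by exact_mod_cast (Real.sqrt_pos.2 two_pos).ne'
  field_simp

/-- **H21's `cornerLine` is `± 2^{1/4} · refPhase c₀ · quarterPhase (dartDir c₀ q)`** — the same
real line as the (rotated) line of the darts carried by `q`. [cite: Smirnov2010, Def. 3.1] -/
theorem cornerLine_eq_or_eq_neg (c₀ q : Site 2 × Fin 4) :
    cornerLine q.1 (cFace q) = (Real.sqrt (Real.sqrt 2) : ℝ) * (refPhase c₀ * quarterPhase (dartDir c₀ q)) ∨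
      cornerLine q.1 (cFace q) = -((Real.sqrt (Real.sqrt 2) : ℝ) * (refPhase c₀ * quarterPhase (dartDir c₀ q))) := by
  rw [← sq_eq_sq_iff_eq_or_eq_neg, cornerLine_sq_eq c₀, mul_pow, mul_pow, ← Complex.ofReal_pow,
    Real.sq_sqrt (Real.sqrt_nonneg 2), mul_pow]

end CornerLine

/-! ### Projections onto a line: only the line matters, and rotations act equivariantly -/

section Proj

open Complex

/-- Scaling the direction vector by a nonzero real does not change the projection (it is the
projection onto the real line `η ℝ`). [cite: ChelkakSmirnov2012, §3.2] -/
theorem projLine_real_mul {t : ℝ} (ht : t ≠ 0) (η F : ℂ) : projLine (t * η) F = projLine η F := by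
  rw [projLine_eq, projLine_eq, map_mul, conj_ofReal, norm_mul, Complex.norm_real, Real.norm_eq_abs, mul_pow,
    sq_abs, Complex.real_smul, Complex.real_smul]
  rcases eq_or_ne η 0 with rfl | hη
  · simp
  · have hη2 : ‖η‖ ^ 2 ≠ 0 := pow_ne_zero _ (norm_ne_zero_iff.2 hη)
    rw [show F * (↑t * (starRingEnd ℂ) η) = ↑t * (F * (starRingEnd ℂ) η) by ring, re_ofReal_mul]
    push_cast
    have htc : (t : ℂ) ≠ 0 := by exact_mod_cast ht
    field_simp

/-- The projection onto `-η ℝ = η ℝ`. [cite: ChelkakSmirnov2012, §3.2] -/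
theorem projLine_neg (η F : ℂ) : projLine (-η) F = projLine η F := by
  have := projLine_real_mul (t := -1) (by norm_num) η F
  rwa [show (((-1 : ℝ) : ℂ)) * η = -η by push_cast; ring] at this

/-- **Rotation equivariance**: projecting `u F` onto the line `u η ℝ` gives `u` times the
projection of `F` onto `η ℝ` (`u ≠ 0`; no normalisation needed). [cite: ChelkakSmirnov2012, §3.2] -/
theorem projLine_mul_mul {u : ℂ} (hu : u ≠ 0) (η F : ℂ) : projLine (u * η) (u * F) = u * projLine η F := by
  rw [projLine_eq, projLine_eq, map_mul, norm_mul, mul_pow, Complex.real_smul, Complex.real_smul]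
  rcases eq_or_ne η 0 with rfl | hη
  · simp
  · have hη2 : ‖η‖ ^ 2 ≠ 0 := pow_ne_zero _ (norm_ne_zero_iff.2 hη)
    have hu2 : ‖u‖ ^ 2 ≠ 0 := pow_ne_zero _ (norm_ne_zero_iff.2 hu)
    have key : (u * F * ((starRingEnd ℂ) u * (starRingEnd ℂ) η)).re = ‖u‖ ^ 2 * (F * (starRingEnd ℂ) η).re := by
      rw [show u * F * ((starRingEnd ℂ) u * (starRingEnd ℂ) η) = (u * (starRingEnd ℂ) u) * (F * (starRingEnd ℂ) η) by ring,
        mul_conj', ← ofReal_pow, re_ofReal_mul]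
    rw [key]
    push_cast
    rw [show (‖u‖ : ℂ) ^ 2 * ((F * (starRingEnd ℂ) η).re : ℂ) / ((‖u‖ : ℂ) ^ 2 * (‖η‖ : ℂ) ^ 2) =
      ((F * (starRingEnd ℂ) η).re : ℂ) / (‖η‖ : ℂ) ^ 2 from mul_div_mul_left _ _ (by exact_mod_cast hu2)]
    ring

end Proj

/-! ### The observable as a finite sum over configurations -/

section Observable

variable {D : DiscreteDobrushin}

open scoped Classical in
/-- **The FK-Ising observable as a finite sum.** For admissible data,
`F(z) = ∑_{ω ⊆ E} (w(ω)/Z) · passageSum (γ_ω) z`, where `γ_ω` is the cut orbit (the exploration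
path) of the completed configuration of `ι ω`, `w` the critical FK weights wired on `A`, `E` the
edges of the interface graph. [cite: Smirnov2010, §2.2 eq. (2.2)] -/
theorem fkIsingObservable_eq_sum (hD : D.IsZdAdmissible) [Fintype (meshDomain D.Ω D.δ)] (z : MedialVertex) :
    fkIsingObservable D criticalFKIsingParam z =
      ∑ ω ∈ D.interfaceGraph.edgeFinset.powerset,
        (rcWeight D.interfaceGraph criticalFKIsingParam 2 (Subtype.val ⁻¹' D.zdArcA) ω /
          rcPartitionFunction D.interfaceGraph criticalFKIsingParam 2 (Subtype.val ⁻¹' D.zdArcA)) •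
        passageSum (explorationList (D.bcBondConfig (liftConfig D.Ω D.δ ω)) (DiscreteDobrushin.startCorner hD)
          (DiscreteDobrushin.exitTime hD (liftConfig D.Ω D.δ ω))) D.δ (1 / 2) z := by
  rw [fkIsingObservable, fkFermionicObservable,
    DiscreteDobrushin.integral_fkInterfaceMeasure D criticalFKIsingParam_mem_Icc two_pos]
  refine Finset.sum_congr rfl fun ω _ => ?_
  rw [fkInterface, DiscreteDobrushin.medialExploration_eq_explorationList hD]

end Observable

end Literature.Probability.LatticeModels
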